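import Summits.Ventures.HodgeRepro2.T5SU11SphericalLegendreHigher
import Summits.Ventures.HodgeRepro2.T5SU11JacobiCrossCheck

/-!
# A third parameter check of the Jacobi transform: `∫_G m_k φ_6 dν = 2πk(k+2)/((k−2)(k−4)(k−6))`

With `φ_6 = (3 φ_4² − 1)/2` (`T5SU11SphericalLegendreHigher`) and `φ_4 = 2|a|² − 1`,
`|a|² = (1 − |g·0|²)⁻¹`, the product `m_k φ_6` is a combination of coefficient moduli,
`m_k φ_6 = 6 m_{k−4} − 6 m_{k−2} + m_k` (`orbit_rpow_mul_sph_six`), so its integral follows from the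
`λ = 0` values `∫_G m_j dν = 2π/(j − 2)` alone: **`∫_G m_k φ_6 dν = 2πk(k+2)/((k−2)(k−4)(k−6))`** for
`k > 6` (`integral_orbit_rpow_mul_sph_six`). Comparing with the general closed form of
`T5SU11JacobiTransform` at `λ = 6` gives the Gamma identity
`2^{k−2} C_k Γ((k−6)/2) Γ(k/2 + 2)/Γ(k−1) = 2πk(k+2)/((k−2)(k−4)(k−6))` (`gamma_value_six`) — the closed
form verified at a THIRD parameter (after `λ = 0` and `λ = 4`, `T5SU11JacobiCrossCheck`) by a route
independent of the Gamma-function evaluation; the same value at `λ = −4 = 2 − 6`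
(`integral_orbit_rpow_mul_sph_neg_four`). Nothing is claimed about (N).

Blind lane: Mathlib + the HodgeRepro2 prefix only; no sorry; axioms ⊆ {propext, Classical.choice,
Quot.sound}.
-/

namespace Summit.Ventures.HodgeRepro2.T5SU11JacobiSix

open MeasureTheory MeasureTheory.Measure Metric Set Filter Topology
open T5SU11Unimodular T5SU11Fibration T5SU11Cartan T5HaarCircle T5BergmanCoefficient
  T5SU11FibrationHaar T5SU11SphericalFunction T5SU11SphericalSymmetry T5SU11SphericalLegendre
  T5SU11SphericalLegendreHigher T5SU11JacobiIwasawa T5SU11JacobiTransform T5SU11JacobiCrossCheck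
open scoped Real

section measure

variable [MeasurableSpace Circle] [BorelSpace Circle]

/-- `m_k · φ_6 = 6 m_{k−4} − 6 m_{k−2} + m_k` pointwise. -/
lemma orbit_rpow_mul_sph_six (k : ℝ) (g : SU11) :
    (1 - ‖orbit g‖ ^ 2) ^ (k / 2) * sph 6 g
      = 6 * (1 - ‖orbit g‖ ^ 2) ^ ((k - 4) / 2) - 6 * (1 - ‖orbit g‖ ^ 2) ^ ((k - 2) / 2)
        + (1 - ‖orbit g‖ ^ 2) ^ (k / 2) := by
  have hpos := one_sub_norm_orbit_sq_pos g
  have ha : ‖mat g 0 0‖ ^ 2 = (1 - ‖orbit g‖ ^ 2)⁻¹ := by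
    rw [one_sub_norm_orbit_sq, inv_pow, inv_inv]
  rw [sph_six_eq_norm_mat, ha, show (k - 4) / 2 = k / 2 - 1 - 1 by ring,
    show (k - 2) / 2 = k / 2 - 1 by ring, Real.rpow_sub_one hpos.ne', Real.rpow_sub_one hpos.ne']
  field_simp
  ring

/-- **`∫_G m_k φ_6 dν = 2πk(k+2)/((k−2)(k−4)(k−6))`** for `k > 6`, by the direct route. -/
theorem integral_orbit_rpow_mul_sph_six {k : ℝ} (hk : 6 < k) :
    ∫ g, (1 - ‖orbit g‖ ^ 2) ^ (k / 2) * sph 6 g ∂(nu haarCircle)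
      = 2 * π * k * (k + 2) / ((k - 2) * (k - 4) * (k - 6)) := by
  simp_rw [orbit_rpow_mul_sph_six]
  have i4 := integrable_orbit_rpow (k := k - 4) (by linarith)
  have i2 := integrable_orbit_rpow (k := k - 2) (by linarith)
  have i0 := integrable_orbit_rpow (k := k) (by linarith)
  have hsub : Integrable (fun g => 6 * (1 - ‖orbit g‖ ^ 2) ^ ((k - 4) / 2)
      - 6 * (1 - ‖orbit g‖ ^ 2) ^ ((k - 2) / 2)) (nu haarCircle) :=
    (i4.const_mul 6).sub (i2.const_mul 6)
  rw [integral_add hsub i0, integral_sub (i4.const_mul 6) (i2.const_mul 6),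
    integral_const_mul, integral_const_mul, integral_orbit_rpow_nu (k := k - 4) (by linarith),
    integral_orbit_rpow_nu (k := k - 2) (by linarith), integral_orbit_rpow_nu (by linarith),
    show k - 4 - 2 = k - 6 by ring, show k - 2 - 2 = k - 4 by ring]
  have h1 : (k - 2) ≠ 0 := by linarith
  have h2 : (k - 4) ≠ 0 := by linarith
  have h3 : (k - 6) ≠ 0 := by linarith
  field_simp
  ring

/-- **THE THIRD-PARAMETER CROSS-CHECK**: the general closed form at `λ = 6` reproduces
`2πk(k+2)/((k−2)(k−4)(k−6))` (`k > 6`). -/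
theorem gamma_value_six {k : ℝ} (hk : 6 < k) :
    2 ^ (k - 2) * (√π * Real.Gamma ((k - 1) / 2) / Real.Gamma (k / 2))
        * (Real.Gamma ((k - 6) / 2) * Real.Gamma ((k + 6) / 2 - 1) / Real.Gamma (k - 1))
      = 2 * π * k * (k + 2) / ((k - 2) * (k - 4) * (k - 6)) := by
  rw [← integral_orbit_rpow_mul_sph (lam := 6) (by linarith) (by linarith) (by linarith)]
  exact integral_orbit_rpow_mul_sph_six hk

/-- The same value at `λ = −4 = 2 − 6` (`φ_{−4} = φ_6`). -/
theorem integral_orbit_rpow_mul_sph_neg_four {k : ℝ} (hk : 6 < k) :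
    ∫ g, (1 - ‖orbit g‖ ^ 2) ^ (k / 2) * sph (-4) g ∂(nu haarCircle)
      = 2 * π * k * (k + 2) / ((k - 2) * (k - 4) * (k - 6)) := by
  rw [← integral_orbit_rpow_mul_sph_six hk]
  congr 1
  funext g
  rw [sph_two_sub (-4) g, show (2 : ℝ) - -4 = 6 by norm_num]

/-- The ratio to the `λ = 0` value: `∫_G m_k φ_6 dν = (k(k+2)/((k−4)(k−6))) ∫_G m_k dν`. -/
theorem integral_orbit_rpow_mul_sph_six_eq_ratio {k : ℝ} (hk : 6 < k) :
    ∫ g, (1 - ‖orbit g‖ ^ 2) ^ (k / 2) * sph 6 g ∂(nu haarCircle)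
      = k * (k + 2) / ((k - 4) * (k - 6)) * ∫ g, (1 - ‖orbit g‖ ^ 2) ^ (k / 2) ∂(nu haarCircle) := by
  rw [integral_orbit_rpow_mul_sph_six hk, integral_orbit_rpow_nu (by linarith)]
  have h1 : (k - 2) ≠ 0 := by linarith
  have h2 : (k - 4) ≠ 0 := by linarith
  have h3 : (k - 6) ≠ 0 := by linarith
  field_simp

end measure

end Summit.Ventures.HodgeRepro2.T5SU11JacobiSix
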